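import Literature.NumberTheory.ComplexMultiplication.ShimuraTaniyamaOfMainTheoremInertia
import HarnessLib

/-!
# Shimura–Taniyama (row II-5), FLAT edition: the family of Hecke characters of a CM structure with Thm. 19.11 read
# ONE WAY («good reduction ⟹ unramified», Lemma 19.5) — from the Main Theorem of CM and the INERTIA hypothesis alone
# ([Shimura 1998, Thm. 19.8, Prop. 19.10, Lemma 19.5, Thm. 19.11; Serre–Tate 1968 §1 Thm. 1 (easy half), §7])

Topic `Literature/NumberTheory/ComplexMultiplication`, namespace `Literature.NumberTheory.ComplexMultiplication`.  THEOREMS ONLY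
(no definition, no named fact, no instance; net Literature debt **0**).  Cell `hodgecm-mathlib`, EDITION E-19.11♭1 (director g3
BATCH 112 over B-plan1's `B6-SPEC.md` §3 (c)): the `h21` binder `shimura1998_thm21_4_casselman` is re-read as Thm. 21.4 + Prop. 19.10
WITHOUT clause (b) «`χ` unramified at `𝔭` iff `A` has good reduction modulo `𝔭`» (Thm. 19.11, first assertion), whose ⟹-half is
Lemma 19.3 = the CONVERSE of the criterion of Néron–Ogg–Šafarevič (`h₃ : hasGoodReductionAt_of_isUnramifiedAt`, [SerreTate1968] §1
Thm. 1 hard direction) and is read by NO consumer of the binder (B6-SPEC §1.3 census).  This file is the `h₃`-FREE sibling of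
`shimuraTaniyama_heckeCharacters_of_thm18_6_of_inertia` (`ShimuraTaniyamaOfMainTheoremInertia.lean`): same steps 1–4 character for
character (Prop. 30: `K* ⊆ k`; §18.4: a uniformisation `ξ` of type `(K, Φ, 𝔞)`; Thm. 19.8: the homomorphism `α` with the lattice
clause, Shimura reciprocity and open kernel; Prop. 19.10: the family `χ_τ = (α/f)_τ`), and step 5 replaced by the PROVED one-way
Thm. 19.11 `forall_localUnits_eq_one_of_hasGoodReductionAt_of_torsionReciprocity_of_inertia` (:138 there; Lemma 19.5: at a place of
good reduction `α(𝔬_v^×) = 1`, from the inertia hypothesis `h₁₂`), so that the conclusion carries clauses (1), (2), (3), (5) of the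
named fact `shimuraTaniyama_heckeCharacters` VERBATIM and clause (4) in the ONE-WAY form

  (4♭) `∀ τ v, HasGoodReductionAt A₀.X A₀.dim v → (χ τ).IsUnramifiedAt v`.

Nothing downstream is touched: `shimuraTaniyama_heckeCharacters` keeps its `↔` and its derivation from `h186 + h₁₂ + h₃`; the flat
producer of the `h21` binder (Summits side, `Summit.HodgeConjecture.CorCM.Hyp21.…`, over the Casselman core) consumes THIS theorem and
never forms clause (4).  HC_CM is proved only modulo the 7 printed citations until rung 0 closes; this file adds no hypothesis to
anything and discharges no binder by itself.

## References
* [Shimura1998] G. Shimura, *Abelian Varieties with Complex Multiplication and Modular Functions*, Princeton Univ. Press (1998):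
  §19.7–19.11 — Thm. 19.8 (p. 134), Prop. 19.10 (19.10a)–(19.10f) (pp. 136–137), Lemma 19.5 (p. 133), Thm. 19.11 first assertion and
  its proof (pp. 137–138); §18.6 Thm. 18.6 (2); §8.5 Prop. 30.
* [SerreTate1968] J.-P. Serre, J. Tate, *Good reduction of abelian varieties*, Ann. of Math. 88 (1968), §1 Thm. 1 (easy direction);
  §7 Thm. 10, Thm. 11 with Cor. 1, Thm. 12.
-/

noncomputable section
open CategoryTheory IsDedekindDomain NumberField
open scoped NumberField nonZeroDivisors ComplexConjugate

namespace Literature.NumberTheory.ComplexMultiplication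

open Literature.AlgebraicGeometry.Motives
open Literature.NumberTheory.GaloisRepresentations

/-- **SHIMURA–TANIYAMA, FLAT EDITION (Shimura 1998 Thm. 19.8 / Prop. 19.10 / Lemma 19.5 = Serre–Tate 1968 §7 Thms. 10–12 with §1
Thm. 1, easy half) FROM THE MAIN THEOREM OF COMPLEX MULTIPLICATION and the INERTIA form of good reduction — no converse
Néron–Ogg–Šafarevič.**  ASSUMING `shimura1998_thm18_6` (row II-1) and the inertia hypothesis `h₁₂` («at a place of good reduction
and for every `ℓ ∤ v`, some prime `𝔓 ∣ v` of `ℤ̄_k` has inertia acting trivially on `T_ℓ A₀`»): every structure `(A₀, ι₀)` of type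
`(K, Φ)` over a number field `k ⊂ ℂ` has a family `(χ_τ)_{τ : K → ℂ}` of Hecke characters of `k` with (1) infinity types
`cmInfinityType Φ τ σ₀` (19.10a,c), (2) `χ_{τ̄} = \overline{χ_τ}` (19.10d), (3) on local idèles the family of embeddings of one
element of `K` (19.10b,c), (4♭) «`A` has good reduction modulo `𝔭` ⟹ `χ_τ` is unramified at `𝔭`» (Thm. 19.11, ⟸-half = Lemma
19.5), (5) at every good place the Frobenius element `π ∈ 𝔬_K`: `χ_τ(ϖ_v) = τ(π)`, every arithmetic Frobenius at `v` acts on `T_ℓ A₀`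
(`ℓ ∤ v`) as `T_ℓ(ι₀ π)`, and `(π)` is the reflex type norm of `𝔭_v` in every normal presentation.  Clauses (1), (2), (3), (5) are the
text of `shimuraTaniyama_heckeCharacters` verbatim; proof = `shimuraTaniyama_heckeCharacters_of_thm18_6_of_inertia` steps 1–4 verbatim,
step 5 := `forall_localUnits_eq_one_of_hasGoodReductionAt_of_torsionReciprocity_of_inertia`.
[cite: Shimura1998, §19.7–19.11: Thm. 19.8 (p. 134), Prop. 19.10 (19.10a–f) (pp. 136–137), Lemma 19.5 (p. 133), Thm. 19.11 and its proof (pp. 137–138); §18.6 Thm. 18.6 (2); §8.5 Prop. 30]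
[cite: SerreTate1968, §7 Thm. 10, Thm. 11 with Cor. 1, Thm. 12; §1 Thm. 1] -/
theorem shimuraTaniyama_heckeCharactersFlat_of_thm18_6_of_inertia (h186 : shimura1998_thm18_6)
    (h₁₂ : ∀ (k : Type) [Field k] [NumberField k] (A₀ : AbelianVariety k) (v : HeightOneSpectrum (𝓞 k)),
      HasGoodReductionAt A₀.X A₀.dim v → ∀ (ℓ : ℕ) [Fact ℓ.Prime], (ℓ : 𝓞 k) ∉ v.asIdeal →
        ∃ 𝔓 ∈ v.primesAbove, ∀ σ ∈ 𝔓.inertia (Field.absoluteGaloisGroup k), A₀.tateRep ℓ σ = 1) :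
    ∀ (k : Type) [Field k] [NumberField k] [Algebra k ℂ] (K : Type) [Field K] [NumberField K]
      [IsCMField K] (Φ : CMType K) (A₀ : AbelianVariety k) (ι₀ : 𝓞 K →+* End A₀),
      IsCMTypeRealisationOver Φ A₀ ι₀ →
      ∃ χ : (K →+* ℂ) → HeckeCharacter k,
        -- (1) infinity type (19.10a,c)
        (∀ τ : K →+* ℂ, (χ τ).HasInfinityType (cmInfinityType Φ.1 τ (algebraMap k ℂ)).1
          (cmInfinityType Φ.1 τ (algebraMap k ℂ)).2) ∧
        -- (2) conjugation (19.10d)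
        (∀ (τ : K →+* ℂ) (x : ideleGroup k),
          ((χ (ComplexEmbedding.conjugate τ) x : ℂˣ) : ℂ) = conj ((χ τ x : ℂˣ) : ℂ)) ∧
        -- (3) values in `K` on finite local ideles (19.10b,c)
        (∀ (v : HeightOneSpectrum (𝓞 k)) (u : (v.adicCompletion k)ˣ),
          ∃ b : K, ∀ τ : K →+* ℂ, ((χ τ (localUnits v u) : ℂˣ) : ℂ) = τ b) ∧
        -- (4♭) good reduction ⟹ unramified (Thm. 19.11, ⟸-half; Lemma 19.5)
        (∀ (τ : K →+* ℂ) (v : HeightOneSpectrum (𝓞 k)),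
          HasGoodReductionAt A₀.X A₀.dim v → (χ τ).IsUnramifiedAt v) ∧
        -- (5) the Frobenius element at a good place
        (∀ v : HeightOneSpectrum (𝓞 k), HasGoodReductionAt A₀.X A₀.dim v →
          ∃ π : 𝓞 K,
            (∀ τ : K →+* ℂ, (χ τ).valueAtUniformizer v = τ (π : K)) ∧
            (∀ (ℓ : ℕ) [Fact ℓ.Prime], (ℓ : 𝓞 k) ∉ v.asIdeal →
              ∀ 𝔓 ∈ v.primesAbove, ∀ σ : Field.absoluteGaloisGroup k, IsArithFrobAt (𝓞 k) σ 𝔓 →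
                A₀.tateRep ℓ σ = AbelianVariety.tateModuleMap ℓ (ι₀ π : A₀ ⟶ A₀)) ∧
            (∀ (L : Type) [Field L] [NumberField L] [Normal ℚ L] (ιL : L →+* ℂ) (j : K →+* L)
              (σL : k →+* L), ιL.comp σL = algebraMap k ℂ →
                IsReflexTypeNorm (valuedIn ιL Φ.1) j σL v.asIdeal (Ideal.span {π}))) := by
  intro k _ _ _ K _ _ _ Φ A₀ ι₀ h
  classical
  -- 1. `K* ⊆ k` (Prop. 30) as instances
  have hK : ((traceField Φ : Set ℂ)) ⊆ Set.range (algebraMap k ℂ) := fun x hx => by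
    have h' := h.traceField_le_fieldRange (show x ∈ (traceField Φ).toSubfield from hx)
    exact RingHom.mem_fieldRange.1 h'
  obtain ⟨_, _⟩ := exists_algebra_isScalarTower_of_subset_range (traceField Φ) k hK
  haveI : NumberField (traceField Φ) := NumberField.mk
  -- 2. «We take `𝔞` so that (18.4a) holds»
  obtain ⟨𝔞, ⟨ξ⟩⟩ := h.exists_cmTypeUniformization
  -- 3. Thm. 19.8: `α`, lattice clause, reciprocity, `α = N_Φ` on `k^×`, `Ker(α)` open
  obtain ⟨α, hL, hR, hprin⟩ := exists_hom_torsion_reciprocity ξ h186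
  have hideal : ∀ x : ideleGroup k, FractionalIdeal.spanSingleton (𝓞 K)⁰ ((α x : Kˣ) : K) =
      Literature.NumberTheory.Automorphic.FiniteAdeleRing.toFractionalIdeal (𝓞 K) K
        (reflexNormFinitePart K Φ (traceField Φ) (Literature.NumberTheory.AdelicBaseChange.ideleRelNorm (↥(traceField Φ)) k x)) :=
    fun x => spanSingleton_eq_toFractionalIdeal_of_ideleMulIdeal_eq (hL x)
  have hker : IsOpen ((α.ker : Subgroup (ideleGroup k)) : Set (ideleGroup k)) := isOpen_ker_of_torsion_reciprocity ξ α hL hR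
  -- 4. Prop. 19.10: the Hecke characters
  obtain ⟨χ, -, h1, h2, h3, hunr, hunits, h5⟩ := exists_heckeCharacters_of_isOpen_ker α hker hprin hideal
  -- 5♭. Thm. 19.11, ⟸-half (Lemma 19.5): at a good place `α(𝔬_v^×) = 1`, from the inertia hypothesis
  have h4 : ∀ v : HeightOneSpectrum (𝓞 k), HasGoodReductionAt A₀.X A₀.dim v →
      ∀ u : (v.adicCompletionIntegers k)ˣ,
        α (localUnits v (Units.map ((v.adicCompletionIntegers k).subtype : _ →* _) u)) = 1 := fun v hv u =>
    forall_localUnits_eq_one_of_hasGoodReductionAt_of_torsionReciprocity_of_inertia ξ α hR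
      (fun u => by
        obtain ⟨b, hb⟩ := hunits v u
        exact ⟨(b : 𝓞 K), hb.symm⟩)
      (fun hg ℓ _ hℓ => h₁₂ k A₀ v hg ℓ hℓ) hv u
  refine ⟨χ, h1, h2, h3, fun τ v hv => (hunr τ v).2 (h4 v hv), fun v hv => ?_⟩
  obtain ⟨π, hπ, h5a, h5c⟩ := h5 v
  refine ⟨π, h5a, fun ℓ _ hℓ 𝔓 h𝔓 σ hσ => ?_, h5c⟩
  exact tateRep_eq_tateModuleMap_of_isArithFrobAt_of_torsionReciprocity ξ α hR (h4 v hv) hπ.symm hℓ h𝔓 hσ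

end Literature.NumberTheory.ComplexMultiplication

end
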